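import Literature.MathematicalPhysics.QuantumManyBody.LeeHuangYangIntegral
import Literature.MathematicalPhysics.QuantumManyBody.DiluteBoseGasLHYIntegral
import Literature.MathematicalPhysics.QuantumManyBody.LHYIntegrandBounds
import Literature.MathematicalPhysics.QuantumManyBody.LHYLatticeSums
import Literature.MathematicalPhysics.QuantumManyBody.PeriodicBoseGasLemma32
import Mathlib.Analysis.Calculus.MeanValue
import HarnessLib

/-!
# Basti–Cenatiempo–Schlein 2021, §3: the Riemann sum (3.21) → the Lee–Huang–Yang integral
# `|h³ ∑_{v ∈ hℤ³∖0} F(v) - ∫_{ℝ³} F| ≤ C h(1 + |log h|)`, `F(v) = √(v⁴+16π𝔞v²) - v² - 8π𝔞 + (8π𝔞)²/(2v²)`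

Topic `Literature/MathematicalPhysics/QuantumManyBody`, companion of `DiluteBoseGasUpperBound.lean`
(provefact `Literature.MathematicalPhysics.QuantumManyBody.BoseGas.BastiCenatiempoSchlein2021_upperBound`)
and of `DiluteBoseGasLHYIntegral.lean` (the value of the integral). Theorem-only file.

In the proof of [BastiCenatiempoSchlein2021, Prop. 1.3] (§3, energy of the trial state
`W(N₀)T_ν e^{A_ν}Ω`, the last step of the proof of Theorem 2.5) the Bogoliubov contribution is
the lattice sum (3.21), `(N^κ/2) ∑_{v ∈ 2πN^{-κ/2}ℤ³∖0} F(v)` with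
`F(v) = √(v⁴ + 16π𝔞v²) - v² - 8π𝔞 + (8π𝔞)²/(2v²)`, and the second-order term
`4π𝔞N^{1+κ}·(128/(15√π))(𝔞³N^{3κ-2})^{1/2}` of (3.22) is obtained by "Recognizing that (3.21)
defines a Riemann sum and explicitly computing `(1/(2(2π)³))∫F = 4π𝔞·(128/(15√π))𝔞^{3/2}`",
with the printed justification: "To compare the Riemann sum in (3.21) with the integral, we first
removed contributions arising from `|v| ≤ N^{-ε}` using that `|F(v)| ≤ C/v²`, for small `v`. For
`|v| > N^{-ε}`, we use that `|∇F(v)| ≤ C|v|⁻³(1+v²)⁻¹` to compare the value of `F(q)` with `F(v)`,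
for all `q` in the cube of size `2πN^{-κ/2}` centered at `v`." This file proves that comparison
as a quantitative statement in the lattice spacing `h` (= `2πN^{-κ/2}` in the paper): for
`0 < h ≤ 1`, `|h³∑_{v ∈ hℤ³∖0} F(v) - ∫_{ℝ³}F| ≤ C_𝔞 h(1 + |log h|)`
(`BastiCenatiempoSchlein2021_lhyRiemannSum`; any positive power of `h` would do in §3, where the
error must be `≤ CN^{5κ/2-ε}` after multiplication by `N^{5κ/2}`).

## The proof

We follow the printed recipe cell by cell on the tiling of `ℝ³` by the cubes `[0,h)³ - hn`,
`n ∈ ℤ³` (`tsum_lintegral_cell_sub_latticeVec` of `PeriodicBoseGasLemma32.lean`), organised by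
the max-norm `|n|∞`, for a general radial profile `G ≥ 0` with `G(r) ≤ A/r²`, `M`-Lipschitz on
`[r₀,∞)` with `M = B₃/r₀³` and, for `r₀ ≥ s`, `M = B₅/r₀⁵`, and `G(|·|)` integrable
(`abs_latticeSum_sub_integral_le`, explicit constants):
* the `27` cells with `|n|∞ ≤ 1` are removed from both sides (`∫ ≤ 16πAh` each, by
  `∫_{B(0,ρ)} A/|x|² = 4πAρ` in polar coordinates, `integral_ball_div_norm_sq`; `h³G(‖hn‖) ≤ Ah`);
* on a cell with `|n|∞ ≥ 2` both `‖u - hn‖` and `‖hn‖` are `≥ h(|n|∞-1)` and differ by `≤ √3h`,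
  so `|∫_{cell} G - h³G(‖hn‖)| ≤ M√3h·h³` by the one-dimensional mean value theorem for the
  radial profile (`abs_cellIntegral_sub_le`);
* with `M = B₃/r₀³` for `2 ≤ |n|∞ ≤ K₁ = ⌈max(s,1)/h⌉ + 1` and `M = B₅/r₀⁵` beyond, the errors
  `8√3B₃h|n|∞⁻³` and `32√3B₅h⁻¹|n|∞⁻⁵` are summed by the shell bounds `∑ |n|∞⁻³ ≤ 96(1 + log K₁)`,
  `∑_{|n|∞ > K₁} |n|∞⁻⁵ ≤ 192/(K₁+1)² ≤ 192h²` (`sum_inv_supNorm_pow_three_le`,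
  `sum_inv_supNorm_pow_five_le`, transported from the `ℕ₀³` bounds of `LHYLatticeSums.lean` along
  `n ↦ (|nᵢ|)ᵢ`, whose fibres have `≤ 8` points);
* the bound is uniform over finite sets of cells, whence summability of the lattice sum and the
  estimate for the full sums (`summable_of_sum_le`, `hasSum_cellIntegral`).
For the LHY profile `F_b(r) = √(r⁴+2br²) - r² - b + b²/(2r²) = b·f(r/√b)` (`b = 8π𝔞`) the
hypotheses hold with `A = b²/2`, `B₃ = 6b²`, `B₅ = 3b³`, `s = √b` by the bounds
`f ≤ 1/(2u²)`, `f ≤ 1/(2u⁴)`, `|f'| ≤ 6u⁻³` (`u ≤ 1`), `|f'| ≤ 3u⁻⁵` (`u ≥ 1`) of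
`LHYIntegrandBounds.lean` (`lhyF_eq_scale`, `abs_lhyF_sub_le_three`, `abs_lhyF_sub_le_five`),
integrability and the value `∫F_b = (32√2π/15)b^{5/2}` are `integrable_bogoliubov`,
`integral_bogoliubov` (`LeeHuangYangIntegral.lean`) and, in the normalisation of (3.22),
`integral_lhyIntegrand` (`DiluteBoseGasLHYIntegral.lean`): `lhy_latticeSum`,
`BastiCenatiempoSchlein2021_lhyRiemannSum`.

## Contents (all proved; no definitions, no named facts)

* profile: `lhyF_eq_scale`, `lhyF_nonneg`, `lhyF_le_sq_div`, `lhyF_le_cube_div`,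
  `hasDerivAt_lhyF`, `abs_lhyF_deriv_le_three`, `abs_lhyF_deriv_le_five`, `abs_lhyF_sub_le_three`,
  `abs_lhyF_sub_le_five`;
* lattice geometry: `natAbs_le_supNorm`, `exists_natAbs_eq_supNorm`, `supNorm_eq_zero_iff`,
  `supNorm_mul_le_norm_latticeVec`, `supNorm_sub_one_mul_le_norm_sub`, `norm_le_of_mem_cell`,
  `norm_sub_latticeVec_lt_of_supNorm_le_one`, `card_filter_supNorm_le_one`,
  `card_filter_natAbs_eq_le`, `sum_le_eight_mul_sum_image`, `sum_inv_supNorm_pow_three_le`,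
  `sum_inv_supNorm_pow_five_le`;
* cells: `integrableOn_radial_translate`, `abs_cellIntegral_sub_le`, `ae_ne_point`,
  `cellIntegral_nonneg`, `integral_ball_div_norm_sq`, `cellIntegral_le_near`, `pointTerm_near`,
  `hasSum_cellIntegral`;
* Riemann sum: `sum_abs_cellIntegral_sub_pointTerm_le`, `abs_latticeSum_sub_integral_le`,
  `lhy_latticeSum`, `lhyF_bcs_eq`, `BastiCenatiempoSchlein2021_lhyRiemannSum`.

## References

* [BastiCenatiempoSchlein2021] G. Basti, S. Cenatiempo, B. Schlein, *A new second-order upper bound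
  for the ground state energy of dilute Bose gases*, Forum Math. Sigma 9 (2021) e74
  (arXiv:2101.06222), §3: (3.21), (3.22) and the paragraph following (3.22) (p. 13 of the arXiv
  text, read from the held copy `paper:arxiv-2101.06222`).
* [FournaisEtAl2024] S. Fournais et al., arXiv:2408.14222, Lemma 8.1 (the same Riemann-sum step on
  the Neumann box; source of the profile bounds of `LHYIntegrandBounds.lean` and of the shell sums
  of `LHYLatticeSums.lean` used here).
-/

noncomputable section

open MeasureTheory MeasureTheory.Measure Set Filter Metric Finset
open scoped ENNReal NNReal Topology

namespace Literature.MathematicalPhysics.QuantumManyBody.BoseGas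

/-! ### The radial profile `F_b(r) = √(r⁴+2br²) - r² - b + b²/(2r²) = b·f(r/√b)` -/

/-- **Scaling**: `F_b(r) = b·f(r/√b)` with `f(u) = √(u⁴+2u²) - u² - 1 + 1/(2u²)` the profile of
`LHYIntegrandBounds.lean` (`b > 0`, all real `r`, including the junk values at `r = 0`).
[folklore] -/
theorem lhyF_eq_scale {b : ℝ} (hb : 0 < b) (r : ℝ) :
    Real.sqrt (r ^ 4 + 2 * b * r ^ 2) - r ^ 2 - b + b ^ 2 / (2 * r ^ 2) =
      b * (Real.sqrt ((r / Real.sqrt b) ^ 4 + 2 * (r / Real.sqrt b) ^ 2) - (r / Real.sqrt b) ^ 2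
        - 1 + 1 / (2 * (r / Real.sqrt b) ^ 2)) := by
  have hsb : 0 < Real.sqrt b := Real.sqrt_pos.2 hb
  have hsb2 : Real.sqrt b ^ 2 = b := Real.sq_sqrt hb.le
  have hu2 : (r / Real.sqrt b) ^ 2 = r ^ 2 / b := by rw [div_pow, hsb2]
  have hu4 : (r / Real.sqrt b) ^ 4 = r ^ 4 / b ^ 2 := by
    rw [show (r / Real.sqrt b) ^ 4 = ((r / Real.sqrt b) ^ 2) ^ 2 by ring, hu2]; ring
  rw [hu4, hu2]
  have hroot : Real.sqrt (r ^ 4 / b ^ 2 + 2 * (r ^ 2 / b)) = Real.sqrt (r ^ 4 + 2 * b * r ^ 2) / b := by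
    rw [show r ^ 4 / b ^ 2 + 2 * (r ^ 2 / b) = (r ^ 4 + 2 * b * r ^ 2) / b ^ 2 by
      field_simp, Real.sqrt_div' _ (sq_nonneg b), Real.sqrt_sq hb.le]
  rw [hroot]
  by_cases hr : r = 0
  · subst hr; simp
  · field_simp

/-- **`F_b ≥ 0`** away from the origin. [folklore] -/
theorem lhyF_nonneg {b : ℝ} (hb : 0 < b) {r : ℝ} (hr : 0 < r) :
    0 ≤ Real.sqrt (r ^ 4 + 2 * b * r ^ 2) - r ^ 2 - b + b ^ 2 / (2 * r ^ 2) := by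
  rw [lhyF_eq_scale hb]
  have hu : 0 < r / Real.sqrt b := div_pos hr (Real.sqrt_pos.2 hb)
  exact mul_nonneg hb.le (bogoliubovProfile_nonneg hu)

/-- **`F_b(r) ≤ b²/(2r²)`** (`r > 0`; the behaviour at the origin). [folklore] -/
theorem lhyF_le_sq_div {b : ℝ} (hb : 0 < b) {r : ℝ} (hr : 0 < r) :
    Real.sqrt (r ^ 4 + 2 * b * r ^ 2) - r ^ 2 - b + b ^ 2 / (2 * r ^ 2) ≤ b ^ 2 / (2 * r ^ 2) := by
  rw [lhyF_eq_scale hb]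
  have hsb : 0 < Real.sqrt b := Real.sqrt_pos.2 hb
  have hu : 0 < r / Real.sqrt b := div_pos hr hsb
  calc b * _ ≤ b * (1 / (2 * (r / Real.sqrt b) ^ 2)) :=
        mul_le_mul_of_nonneg_left (bogoliubovProfile_le_inv_sq hu) hb.le
    _ = b ^ 2 / (2 * r ^ 2) := by
        rw [div_pow, Real.sq_sqrt hb.le]
        field_simp

/-- **`F_b(r) ≤ b³/(2r⁴)`** (`r > 0`; the decay at infinity). [folklore] -/
theorem lhyF_le_cube_div {b : ℝ} (hb : 0 < b) {r : ℝ} (hr : 0 < r) :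
    Real.sqrt (r ^ 4 + 2 * b * r ^ 2) - r ^ 2 - b + b ^ 2 / (2 * r ^ 2) ≤ b ^ 3 / (2 * r ^ 4) := by
  rw [lhyF_eq_scale hb]
  have hsb : 0 < Real.sqrt b := Real.sqrt_pos.2 hb
  have hu : 0 < r / Real.sqrt b := div_pos hr hsb
  calc b * _ ≤ b * (1 / (2 * (r / Real.sqrt b) ^ 4)) :=
        mul_le_mul_of_nonneg_left (bogoliubovProfile_le_inv_pow_four hu) hb.le
    _ = b ^ 3 / (2 * r ^ 4) := by
        rw [div_pow, show Real.sqrt b ^ 4 = (Real.sqrt b ^ 2) ^ 2 by ring, Real.sq_sqrt hb.le]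
        field_simp

/-- **The derivative of `F_b`**: `F_b'(r) = √b · f'(r/√b)` for `r > 0`, with
`f'(u) = 2(u²+1)/√(u²+2) - 2u - u⁻³`. [folklore] -/
theorem hasDerivAt_lhyF {b : ℝ} (hb : 0 < b) {r : ℝ} (hr : 0 < r) :
    HasDerivAt (fun r : ℝ => Real.sqrt (r ^ 4 + 2 * b * r ^ 2) - r ^ 2 - b + b ^ 2 / (2 * r ^ 2))
      (Real.sqrt b * (2 * ((r / Real.sqrt b) ^ 2 + 1) / Real.sqrt ((r / Real.sqrt b) ^ 2 + 2)
        - 2 * (r / Real.sqrt b) - ((r / Real.sqrt b) ^ 3)⁻¹)) r := by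
  have hsb : 0 < Real.sqrt b := Real.sqrt_pos.2 hb
  have hu : 0 < r / Real.sqrt b := div_pos hr hsb
  have hf := hasDerivAt_bogoliubovProfile hu
  have hlin : HasDerivAt (fun r : ℝ => r / Real.sqrt b) (1 / Real.sqrt b) r := by
    simpa using (hasDerivAt_id r).div_const (Real.sqrt b)
  have hcomp := hf.comp r hlin
  have hmul := hcomp.const_mul b
  have hfun : (fun r : ℝ => Real.sqrt (r ^ 4 + 2 * b * r ^ 2) - r ^ 2 - b + b ^ 2 / (2 * r ^ 2)) =
      fun r : ℝ => b * ((fun u : ℝ => Real.sqrt (u ^ 4 + 2 * u ^ 2) - u ^ 2 - 1 + 1 / (2 * u ^ 2)) ∘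
        fun r : ℝ => r / Real.sqrt b) r := by
    funext s
    exact lhyF_eq_scale hb s
  rw [hfun]
  refine hmul.congr_deriv ?_
  set D : ℝ := 2 * ((r / Real.sqrt b) ^ 2 + 1) / Real.sqrt ((r / Real.sqrt b) ^ 2 + 2)
    - 2 * (r / Real.sqrt b) - ((r / Real.sqrt b) ^ 3)⁻¹
  calc b * (D * (1 / Real.sqrt b)) = (b / Real.sqrt b) * D := by ring
    _ = Real.sqrt b * D := by rw [Real.div_sqrt]

/-- **`|F_b'(r)| ≤ 6b²/r³`** for all `r > 0` (from `|f'| ≤ 6u⁻³` on `(0,1]` and `|f'| ≤ 3u⁻⁵ ≤ 6u⁻³`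
on `[1,∞)`). [folklore] -/
theorem abs_lhyF_deriv_le_three {b : ℝ} (hb : 0 < b) {r : ℝ} (hr : 0 < r) :
    |Real.sqrt b * (2 * ((r / Real.sqrt b) ^ 2 + 1) / Real.sqrt ((r / Real.sqrt b) ^ 2 + 2)
        - 2 * (r / Real.sqrt b) - ((r / Real.sqrt b) ^ 3)⁻¹)| ≤ 6 * b ^ 2 / r ^ 3 := by
  have hsb : 0 < Real.sqrt b := Real.sqrt_pos.2 hb
  set u : ℝ := r / Real.sqrt b with hu_def
  have hu : 0 < u := div_pos hr hsb
  have hf : |2 * (u ^ 2 + 1) / Real.sqrt (u ^ 2 + 2) - 2 * u - (u ^ 3)⁻¹| ≤ 6 / u ^ 3 := by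
    rcases le_or_gt u 1 with h1 | h1
    · exact abs_bogoliubovProfile_deriv_le_of_le_one hu h1
    · refine (abs_bogoliubovProfile_deriv_le_of_one_le h1.le).trans ?_
      rw [div_le_div_iff₀ (by positivity) (by positivity)]
      have hu3 : 0 < u ^ 3 := by positivity
      have hu2 : 1 ≤ u ^ 2 := one_le_pow₀ h1.le
      nlinarith
  rw [abs_mul, abs_of_pos hsb]
  have hru : r = Real.sqrt b * u := by rw [hu_def]; field_simp
  calc Real.sqrt b * |2 * (u ^ 2 + 1) / Real.sqrt (u ^ 2 + 2) - 2 * u - (u ^ 3)⁻¹|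
      ≤ Real.sqrt b * (6 / u ^ 3) := mul_le_mul_of_nonneg_left hf hsb.le
    _ = 6 * b ^ 2 / r ^ 3 := by
        rw [hru, mul_pow, show Real.sqrt b ^ 3 = Real.sqrt b ^ 2 * Real.sqrt b by ring,
          Real.sq_sqrt hb.le]
        field_simp
        rw [show Real.sqrt b ^ 2 = b from Real.sq_sqrt hb.le]

/-- **`|F_b'(r)| ≤ 3b³/r⁵`** for `r ≥ √b` (from `|f'| ≤ 3u⁻⁵` on `[1,∞)`). [folklore] -/
theorem abs_lhyF_deriv_le_five {b : ℝ} (hb : 0 < b) {r : ℝ} (hr : Real.sqrt b ≤ r) :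
    |Real.sqrt b * (2 * ((r / Real.sqrt b) ^ 2 + 1) / Real.sqrt ((r / Real.sqrt b) ^ 2 + 2)
        - 2 * (r / Real.sqrt b) - ((r / Real.sqrt b) ^ 3)⁻¹)| ≤ 3 * b ^ 3 / r ^ 5 := by
  have hsb : 0 < Real.sqrt b := Real.sqrt_pos.2 hb
  have hr0 : 0 < r := hsb.trans_le hr
  set u : ℝ := r / Real.sqrt b with hu_def
  have hu1 : 1 ≤ u := by rwa [hu_def, le_div_iff₀ hsb, one_mul]
  have hu : 0 < u := by linarith
  have hf := abs_bogoliubovProfile_deriv_le_of_one_le hu1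
  rw [abs_mul, abs_of_pos hsb]
  have hru : r = Real.sqrt b * u := by rw [hu_def]; field_simp
  calc Real.sqrt b * |2 * (u ^ 2 + 1) / Real.sqrt (u ^ 2 + 2) - 2 * u - (u ^ 3)⁻¹|
      ≤ Real.sqrt b * (3 / u ^ 5) := mul_le_mul_of_nonneg_left hf hsb.le
    _ = 3 * b ^ 3 / r ^ 5 := by
        rw [hru, mul_pow, show Real.sqrt b ^ 5 = (Real.sqrt b ^ 2) ^ 2 * Real.sqrt b by ring,
          Real.sq_sqrt hb.le]
        field_simp
        rw [show Real.sqrt b ^ 2 = b from Real.sq_sqrt hb.le]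

/-- **Mean value bound near the origin**: for `0 < r₀ ≤ r, s`,
`|F_b(r) - F_b(s)| ≤ (6b²/r₀³)|r - s|`. [folklore] -/
theorem abs_lhyF_sub_le_three {b : ℝ} (hb : 0 < b) {r₀ r s : ℝ} (hr₀ : 0 < r₀) (hr : r₀ ≤ r)
    (hs : r₀ ≤ s) :
    |(Real.sqrt (r ^ 4 + 2 * b * r ^ 2) - r ^ 2 - b + b ^ 2 / (2 * r ^ 2)) -
        (Real.sqrt (s ^ 4 + 2 * b * s ^ 2) - s ^ 2 - b + b ^ 2 / (2 * s ^ 2))| ≤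
      6 * b ^ 2 / r₀ ^ 3 * |r - s| := by
  have hconv : Convex ℝ (Set.Ici r₀) := convex_Ici r₀
  have key := hconv.norm_image_sub_le_of_norm_hasDerivWithin_le
    (f := fun r : ℝ => Real.sqrt (r ^ 4 + 2 * b * r ^ 2) - r ^ 2 - b + b ^ 2 / (2 * r ^ 2))
    (f' := fun r : ℝ => Real.sqrt b * (2 * ((r / Real.sqrt b) ^ 2 + 1) /
      Real.sqrt ((r / Real.sqrt b) ^ 2 + 2) - 2 * (r / Real.sqrt b) - ((r / Real.sqrt b) ^ 3)⁻¹))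
    (C := 6 * b ^ 2 / r₀ ^ 3) (fun x hx => (hasDerivAt_lhyF hb (hr₀.trans_le hx)).hasDerivWithinAt)
    (fun x hx => by
      have hx0 : 0 < x := hr₀.trans_le hx
      rw [Real.norm_eq_abs]
      refine (abs_lhyF_deriv_le_three hb hx0).trans ?_
      rw [div_le_div_iff₀ (by positivity) (by positivity)]
      have : r₀ ^ 3 ≤ x ^ 3 := pow_le_pow_left₀ hr₀.le hx 3
      nlinarith [sq_nonneg b])
    hs hr
  rw [Real.norm_eq_abs, Real.norm_eq_abs] at key
  exact key

/-- **Mean value bound at infinity**: for `√b ≤ r₀ ≤ r, s`,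
`|F_b(r) - F_b(s)| ≤ (3b³/r₀⁵)|r - s|`. [folklore] -/
theorem abs_lhyF_sub_le_five {b : ℝ} (hb : 0 < b) {r₀ r s : ℝ} (hr₀ : Real.sqrt b ≤ r₀) (hr : r₀ ≤ r)
    (hs : r₀ ≤ s) :
    |(Real.sqrt (r ^ 4 + 2 * b * r ^ 2) - r ^ 2 - b + b ^ 2 / (2 * r ^ 2)) -
        (Real.sqrt (s ^ 4 + 2 * b * s ^ 2) - s ^ 2 - b + b ^ 2 / (2 * s ^ 2))| ≤
      3 * b ^ 3 / r₀ ^ 5 * |r - s| := by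
  have hsb : 0 < Real.sqrt b := Real.sqrt_pos.2 hb
  have hr₀0 : 0 < r₀ := hsb.trans_le hr₀
  have hconv : Convex ℝ (Set.Ici r₀) := convex_Ici r₀
  have key := hconv.norm_image_sub_le_of_norm_hasDerivWithin_le
    (f := fun r : ℝ => Real.sqrt (r ^ 4 + 2 * b * r ^ 2) - r ^ 2 - b + b ^ 2 / (2 * r ^ 2))
    (f' := fun r : ℝ => Real.sqrt b * (2 * ((r / Real.sqrt b) ^ 2 + 1) /
      Real.sqrt ((r / Real.sqrt b) ^ 2 + 2) - 2 * (r / Real.sqrt b) - ((r / Real.sqrt b) ^ 3)⁻¹))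
    (C := 3 * b ^ 3 / r₀ ^ 5) (fun x hx => (hasDerivAt_lhyF hb (hr₀0.trans_le hx)).hasDerivWithinAt)
    (fun x hx => by
      have hx0 : 0 < x := hr₀0.trans_le hx
      rw [Real.norm_eq_abs]
      refine (abs_lhyF_deriv_le_five hb (hr₀.trans hx)).trans ?_
      rw [div_le_div_iff₀ (by positivity) (by positivity)]
      have : r₀ ^ 5 ≤ x ^ 5 := pow_le_pow_left₀ hr₀0.le hx 5
      nlinarith [pow_pos hb 3])
    hs hr
  rw [Real.norm_eq_abs, Real.norm_eq_abs] at key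
  exact key


/-! ### Lattice geometry: the max-norm `|n|∞` of `n ∈ ℤ³` and the cells `[0,h)³ - hn` -/

/-- `|nᵢ| ≤ |n|∞`. [folklore] -/
theorem natAbs_le_supNorm (n : Fin 3 → ℤ) (i : Fin 3) :
    (n i).natAbs ≤ univ.sup fun j => (n j).natAbs :=
  Finset.le_sup (f := fun j => (n j).natAbs) (mem_univ i)

/-- The max-norm is attained. [folklore] -/
theorem exists_natAbs_eq_supNorm (n : Fin 3 → ℤ) :
    ∃ i, (n i).natAbs = univ.sup fun j => (n j).natAbs := by
  obtain ⟨i, -, hi⟩ := exists_mem_eq_sup univ univ_nonempty (fun j => (n j).natAbs)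
  exact ⟨i, hi.symm⟩

/-- `|n|∞ = 0 ↔ n = 0`. [folklore] -/
theorem supNorm_eq_zero_iff (n : Fin 3 → ℤ) : (univ.sup fun j => (n j).natAbs) = 0 ↔ n = 0 := by
  constructor
  · intro h
    funext i
    have := natAbs_le_supNorm n i
    rw [h, Nat.le_zero, Int.natAbs_eq_zero] at this
    exact this
  · rintro rfl
    simp

/-- **`h|n|∞ ≤ ‖hn‖`.** [folklore] -/
theorem supNorm_mul_le_norm_latticeVec {h : ℝ} (hh : 0 ≤ h) (n : Fin 3 → ℤ) :
    h * ((univ.sup fun j => (n j).natAbs : ℕ) : ℝ) ≤ ‖latticeVec h n‖ := by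
  obtain ⟨i, hi⟩ := exists_natAbs_eq_supNorm n
  rw [← hi]
  calc h * ((n i).natAbs : ℝ) = ‖latticeVec h n i‖ := by
        rw [Real.norm_eq_abs, latticeVec_apply, abs_mul, abs_of_nonneg hh, Nat.cast_natAbs,
          Int.cast_abs]
    _ ≤ ‖latticeVec h n‖ := PiLp.norm_apply_le _ i

/-- **`‖u - hn‖ ≥ h(|n|∞ - 1)` for `u ∈ [0,h)³`.** [folklore] -/
theorem supNorm_sub_one_mul_le_norm_sub {h : ℝ} (hh : 0 < h) {u : Space} (hu : u ∈ cell h)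
    (n : Fin 3 → ℤ) :
    h * (((univ.sup fun j => (n j).natAbs : ℕ) : ℝ) - 1) ≤ ‖u - latticeVec h n‖ := by
  obtain ⟨i, hi⟩ := exists_natAbs_eq_supNorm n
  rw [← hi]
  have hui : u i ∈ Set.Ico 0 h := hu i
  have habs : |u i| < h := abs_lt.2 ⟨by linarith [hui.1], hui.2⟩
  have htri : |h * (n i : ℝ)| - |u i| ≤ |u i - h * (n i : ℝ)| := by
    have := abs_sub_abs_le_abs_sub (h * (n i : ℝ)) (u i)
    rwa [abs_sub_comm] at this
  calc h * (((n i).natAbs : ℝ) - 1) = |h * (n i : ℝ)| - h := by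
        rw [abs_mul, abs_of_pos hh, Nat.cast_natAbs, Int.cast_abs]; ring
    _ ≤ |u i - h * (n i : ℝ)| := by linarith
    _ = ‖(u - latticeVec h n) i‖ := by
        rw [Real.norm_eq_abs, PiLp.sub_apply, latticeVec_apply]
    _ ≤ ‖u - latticeVec h n‖ := PiLp.norm_apply_le _ i

/-- **`‖u‖ ≤ √3 h` for `u ∈ [0,h)³`.** [folklore] -/
theorem norm_le_of_mem_cell {h : ℝ} (hh : 0 < h) {u : Space} (hu : u ∈ cell h) :
    ‖u‖ ≤ Real.sqrt 3 * h := by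
  rw [EuclideanSpace.norm_eq]
  have hcomp : ∀ i, ‖u i‖ ^ 2 ≤ h ^ 2 := fun i => by
    have hui : u i ∈ Set.Ico 0 h := hu i
    rw [Real.norm_eq_abs, sq_abs]
    nlinarith [hui.1, hui.2]
  have hsum : ∑ i, ‖u i‖ ^ 2 ≤ 3 * h ^ 2 :=
    calc ∑ i, ‖u i‖ ^ 2 ≤ ∑ _i : Fin 3, h ^ 2 := Finset.sum_le_sum fun i _ => hcomp i
      _ = 3 * h ^ 2 := by simp
  calc Real.sqrt (∑ i, ‖u i‖ ^ 2) ≤ Real.sqrt (3 * h ^ 2) := Real.sqrt_le_sqrt hsum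
    _ = Real.sqrt 3 * h := by rw [Real.sqrt_mul (by norm_num), Real.sqrt_sq hh.le]

/-- **`‖u - hn‖ < 4h` for `u ∈ [0,h)³` and `|n|∞ ≤ 1`** (the near cells lie in the ball `B(0,4h)`).
[folklore] -/
theorem norm_sub_latticeVec_lt_of_supNorm_le_one {h : ℝ} (hh : 0 < h) {u : Space} (hu : u ∈ cell h)
    {n : Fin 3 → ℤ} (hn : (univ.sup fun j => (n j).natAbs) ≤ 1) :
    ‖u - latticeVec h n‖ < 4 * h := by
  have hcomp : ∀ i, ‖(u - latticeVec h n) i‖ ^ 2 ≤ 4 * h ^ 2 := fun i => by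
    have hui : u i ∈ Set.Ico 0 h := hu i
    have hni : ((n i).natAbs : ℝ) ≤ 1 := by exact_mod_cast (natAbs_le_supNorm n i).trans hn
    rw [Nat.cast_natAbs, Int.cast_abs] at hni
    rw [Real.norm_eq_abs, sq_abs, PiLp.sub_apply, latticeVec_apply]
    have h1 : |u i - h * (n i : ℝ)| ≤ 2 * h := by
      calc |u i - h * (n i : ℝ)| ≤ |u i| + |h * (n i : ℝ)| := abs_sub _ _
        _ ≤ h + h * 1 := by
            rw [abs_mul, abs_of_pos hh]
            gcongr
            exact (abs_lt.2 ⟨by linarith [hui.1], hui.2⟩).le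
        _ = 2 * h := by ring
    nlinarith [abs_nonneg (u i - h * (n i : ℝ)), sq_abs (u i - h * (n i : ℝ))]
  rw [EuclideanSpace.norm_eq]
  have hsum : ∑ i, ‖(u - latticeVec h n) i‖ ^ 2 ≤ 12 * h ^ 2 :=
    calc ∑ i, ‖(u - latticeVec h n) i‖ ^ 2 ≤ ∑ _i : Fin 3, 4 * h ^ 2 :=
          Finset.sum_le_sum fun i _ => hcomp i
      _ = 12 * h ^ 2 := by simp; ring
  calc Real.sqrt (∑ i, ‖(u - latticeVec h n) i‖ ^ 2) ≤ Real.sqrt (12 * h ^ 2) := Real.sqrt_le_sqrt hsum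
    _ < 4 * h := by
        rw [Real.sqrt_lt' (by positivity)]
        nlinarith

/-! ### The cell integrals `I_n = ∫_{[0,h)³} G(‖u - hn‖) du` of a radial function -/

/-- A radial integrable function is integrable on every translate of every set. [folklore] -/
theorem integrableOn_radial_translate {G : ℝ → ℝ} (hG : Integrable fun p : Space => G ‖p‖)
    (c : Space) (s : Set Space) : IntegrableOn (fun u : Space => G ‖u - c‖) s :=
  (hG.comp_sub_right c).integrableOn

/-- **Far cells** (`|n|∞ ≥ 2`): if `G` is `M`-Lipschitz on `[h(|n|∞-1), ∞)`, then
`|∫_{[0,h)³} G(‖u-hn‖)du - h³G(‖hn‖)| ≤ M√3h · h³`. [cite: BastiCenatiempoSchlein2021, §3, after (3.22): "we use that |∇F(v)| ≤ … to compare the value of F(q) with F(v), for all q in the cube … centered at v"] -/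
theorem abs_cellIntegral_sub_le {G : ℝ → ℝ} {h M : ℝ} (hG : Integrable fun p : Space => G ‖p‖)
    (hh : 0 < h) (n : Fin 3 → ℤ) (hK : 2 ≤ univ.sup fun j => (n j).natAbs)
    (hM : ∀ r s : ℝ, h * (((univ.sup fun j => (n j).natAbs : ℕ) : ℝ) - 1) ≤ r →
      h * (((univ.sup fun j => (n j).natAbs : ℕ) : ℝ) - 1) ≤ s → |G r - G s| ≤ M * |r - s|) :
    |(∫ u in cell h, G ‖u - latticeVec h n‖) - h ^ 3 * G ‖latticeVec h n‖| ≤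
      M * (Real.sqrt 3 * h) * h ^ 3 := by
  set K : ℕ := univ.sup fun j => (n j).natAbs with hKdef
  set c : Space := latticeVec h n with hc
  have hvol : (volume : Measure Space).real (cell h) = h ^ 3 := by
    rw [measureReal_def, volume_cell, ← ENNReal.ofReal_pow hh.le, ENNReal.toReal_ofReal (by positivity)]
  have hvol' : (volume : Measure Space) (cell h) < ⊤ := by
    rw [volume_cell]; exact ENNReal.pow_lt_top ENNReal.ofReal_lt_top
  have hconst : h ^ 3 * G ‖c‖ = ∫ _u in cell h, G ‖c‖ := by
    rw [setIntegral_const, hvol, smul_eq_mul]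
  have hint : IntegrableOn (fun u : Space => G ‖u - c‖) (cell h) := integrableOn_radial_translate hG c _
  rw [hconst, ← integral_sub hint (integrableOn_const hvol'.ne)]
  have hK2 : (2 : ℝ) ≤ K := by exact_mod_cast hK
  have hbound : ∀ u ∈ cell h, ‖G ‖u - c‖ - G ‖c‖‖ ≤ M * (Real.sqrt 3 * h) := by
    intro u hu
    rw [Real.norm_eq_abs]
    have h1 : h * ((K : ℝ) - 1) ≤ ‖u - c‖ := supNorm_sub_one_mul_le_norm_sub hh hu n
    have h2 : h * ((K : ℝ) - 1) ≤ ‖c‖ := by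
      calc h * ((K : ℝ) - 1) ≤ h * (K : ℝ) := by nlinarith
        _ ≤ ‖c‖ := supNorm_mul_le_norm_latticeVec hh.le n
    have h3 : |‖u - c‖ - ‖c‖| ≤ Real.sqrt 3 * h := by
      have := abs_norm_sub_norm_le (u - c) (-c)
      rw [norm_neg, show u - c - -c = u by abel] at this
      exact this.trans (norm_le_of_mem_cell hh hu)
    have hM0 : 0 ≤ M := by
      have := hM (‖c‖ + 1) ‖c‖ (by linarith) h2
      rw [show ‖c‖ + 1 - ‖c‖ = 1 by ring, abs_one, mul_one] at this
      exact (abs_nonneg _).trans this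
    calc |G ‖u - c‖ - G ‖c‖| ≤ M * |‖u - c‖ - ‖c‖| := hM _ _ h1 h2
      _ ≤ M * (Real.sqrt 3 * h) := mul_le_mul_of_nonneg_left h3 hM0
  have := norm_setIntegral_le_of_norm_le_const hvol' hbound
  rw [Real.norm_eq_abs, hvol] at this
  exact this

/-- **Volume has no atoms on `ℝ³`**: `u ≠ c` almost everywhere. [folklore] -/
theorem ae_ne_point (c : Space) : ∀ᵐ u : Space, u ≠ c := by
  have h0 : (volume : Measure Space) {c} = 0 := measure_singleton c
  filter_upwards [compl_mem_ae_iff.2 h0] with u hu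
  exact hu

/-- **The cell integrals of a radial function that is non-negative off the origin are
non-negative.** [folklore] -/
theorem cellIntegral_nonneg {G : ℝ → ℝ} (h0 : ∀ r, 0 < r → 0 ≤ G r) (h : ℝ) (c : Space) :
    0 ≤ ∫ u in cell h, G ‖u - c‖ := by
  apply setIntegral_nonneg_of_ae
  filter_upwards [ae_ne_point c] with u hu
  exact h0 _ (norm_pos_iff.2 (sub_ne_zero.2 hu))

/-- `∫_{B(0,ρ)} A/‖x‖² dx = 4πAρ` on `ℝ³` (polar coordinates), together with the integrability
of `A/‖x‖²` on the ball. [folklore] -/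
theorem integral_ball_div_norm_sq (A : ℝ) {ρ : ℝ} (hρ : 0 < ρ) :
    IntegrableOn (fun x : Space => A / ‖x‖ ^ 2) (ball 0 ρ) ∧
      ∫ x in ball (0 : Space) ρ, A / ‖x‖ ^ 2 = 4 * Real.pi * A * ρ := by
  set g : ℝ → ℝ := fun r => if r < ρ then A / r ^ 2 else 0 with hg
  have hind : (ball (0 : Space) ρ).indicator (fun x : Space => A / ‖x‖ ^ 2) = fun x => g ‖x‖ := by
    funext x
    by_cases hx : x ∈ ball (0 : Space) ρ
    · rw [Set.indicator_of_mem hx]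
      rw [mem_ball_zero_iff] at hx
      simp [hg, hx]
    · rw [Set.indicator_of_notMem hx]
      rw [mem_ball_zero_iff, not_lt] at hx
      simp [hg, not_lt.2 hx]
  have hrad : ∀ r ∈ Set.Ioi (0 : ℝ), r ^ (3 - 1) • g r = (Set.Iio ρ).indicator (fun _ => A) r := by
    intro r hr
    have hr0 : (r : ℝ) ≠ 0 := (ne_of_gt hr)
    by_cases hrρ : r < ρ
    · rw [Set.indicator_of_mem (show r ∈ Set.Iio ρ from hrρ), smul_eq_mul]
      simp only [hg, if_pos hrρ, show (3 : ℕ) - 1 = 2 from rfl]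
      field_simp
    · rw [Set.indicator_of_notMem (show r ∉ Set.Iio ρ from hrρ), smul_eq_mul]
      simp [hg, if_neg hrρ]
  have hIoi : IntegrableOn (fun r : ℝ => r ^ (3 - 1) • g r) (Set.Ioi 0) := by
    have h1 : IntegrableOn (fun r : ℝ => (Set.Iio ρ).indicator (fun _ => A) r) (Set.Ioi 0) := by
      rw [IntegrableOn, integrable_indicator_iff measurableSet_Iio]
      rw [IntegrableOn, Measure.restrict_restrict measurableSet_Iio]
      refine integrableOn_const ?_
      rw [Set.Iio_inter_Ioi]
      exact (measure_Ioo_lt_top).ne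
    exact h1.congr_fun (fun r hr => (hrad r hr).symm) measurableSet_Ioi
  have hdim : Module.finrank ℝ Space = 3 := by simp [Space]
  have hint : Integrable (fun x : Space => g ‖x‖) := by
    have h := integrable_fun_norm_addHaar (volume : Measure Space) (f := g)
    rw [hdim] at h
    exact h.2 hIoi
  constructor
  · rw [← integrable_indicator_iff measurableSet_ball, hind]
    exact hint
  · rw [← integral_indicator measurableSet_ball, hind, integral_fun_norm_addHaar volume g, hdim]
    have hball : (volume : Measure Space).real (ball 0 1) = Real.pi * 4 / 3 := by
      rw [Measure.real, EuclideanSpace.volume_ball_fin_three]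
      rw [ENNReal.ofReal_one, one_pow, one_mul, ENNReal.toReal_ofReal (by positivity)]
    rw [hball, setIntegral_congr_fun measurableSet_Ioi hrad, setIntegral_indicator measurableSet_Iio,
      Set.Ioi_inter_Iio, setIntegral_const]
    rw [Real.volume_real_Ioo_of_le hρ.le, sub_zero, smul_eq_mul, smul_eq_mul, nsmul_eq_mul]
    push_cast
    ring

/-- **Near cells** (`|n|∞ ≤ 1`): if `G(r) ≤ A/r²` off the origin then
`∫_{[0,h)³} G(‖u-hn‖)du ≤ 16πAh` (the cell lies in `B(hn,4h)`). [cite: BastiCenatiempoSchlein2021, §3, after (3.22): "we first removed contributions arising from |v| ≤ N^{-ε} using that |F(v)| ≤ C/v², for small v"] -/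
theorem cellIntegral_le_near {G : ℝ → ℝ} {A h : ℝ} (hG : Integrable fun p : Space => G ‖p‖)
    (hA : ∀ r, 0 < r → G r ≤ A / r ^ 2) (hA0 : 0 ≤ A) (hh : 0 < h) {n : Fin 3 → ℤ}
    (hn : (univ.sup fun j => (n j).natAbs) ≤ 1) :
    ∫ u in cell h, G ‖u - latticeVec h n‖ ≤ 16 * Real.pi * A * h := by
  set c : Space := latticeVec h n with hc
  have hρ : 0 < 4 * h := by positivity
  obtain ⟨hgi, hgv⟩ := integral_ball_div_norm_sq A hρ
  have hfun : (ball c (4 * h)).indicator (fun u : Space => A / ‖u - c‖ ^ 2) =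
      fun t => (ball (0 : Space) (4 * h)).indicator (fun x : Space => A / ‖x‖ ^ 2) (t - c) := by
    funext u
    simp only [Set.indicator, mem_ball, dist_eq_norm, sub_zero]
  have hgi' : IntegrableOn (fun u : Space => A / ‖u - c‖ ^ 2) (ball c (4 * h)) := by
    rw [← integrable_indicator_iff measurableSet_ball] at hgi ⊢
    rw [hfun]
    exact hgi.comp_sub_right c
  have hgv' : ∫ u in ball c (4 * h), A / ‖u - c‖ ^ 2 = 4 * Real.pi * A * (4 * h) := by
    rw [← hgv, ← integral_indicator measurableSet_ball, ← integral_indicator measurableSet_ball, hfun]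
    exact integral_sub_right_eq_self _ c
  have hsub : cell h ⊆ ball c (4 * h) := fun u hu => by
    rw [mem_ball, dist_eq_norm]
    exact norm_sub_latticeVec_lt_of_supNorm_le_one hh hu hn
  calc ∫ u in cell h, G ‖u - c‖
      ≤ ∫ u in cell h, A / ‖u - c‖ ^ 2 := by
        apply setIntegral_mono_ae (integrableOn_radial_translate hG c _) (hgi'.mono_set hsub)
        filter_upwards [ae_ne_point c] with u hu
        exact hA _ (norm_pos_iff.2 (sub_ne_zero.2 hu))
    _ ≤ ∫ u in ball c (4 * h), A / ‖u - c‖ ^ 2 := by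
        apply setIntegral_mono_set hgi'
        · exact Eventually.of_forall fun u => by positivity
        · exact Eventually.of_forall hsub
    _ = 16 * Real.pi * A * h := by rw [hgv']; ring

/-- **Near lattice points** (`n ≠ 0`, `|n|∞ ≤ 1`): `0 ≤ h³G(‖hn‖) ≤ Ah`. [folklore] -/
theorem pointTerm_near {G : ℝ → ℝ} {A h : ℝ} (h0 : ∀ r, 0 < r → 0 ≤ G r)
    (hA : ∀ r, 0 < r → G r ≤ A / r ^ 2) (hh : 0 < h) {n : Fin 3 → ℤ} (hn0 : n ≠ 0)
    (hn : (univ.sup fun j => (n j).natAbs) ≤ 1) :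
    0 ≤ h ^ 3 * G ‖latticeVec h n‖ ∧ h ^ 3 * G ‖latticeVec h n‖ ≤ A * h := by
  have hK1 : (univ.sup fun j => (n j).natAbs) = 1 := by
    refine le_antisymm hn (Nat.one_le_iff_ne_zero.2 fun h' => hn0 ((supNorm_eq_zero_iff n).1 h'))
  have hnorm : h ≤ ‖latticeVec h n‖ := by
    have := supNorm_mul_le_norm_latticeVec hh.le n
    rwa [hK1, Nat.cast_one, mul_one] at this
  have hpos : 0 < ‖latticeVec h n‖ := hh.trans_le hnorm
  refine ⟨mul_nonneg (by positivity) (h0 _ hpos), ?_⟩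
  have hA0 : 0 ≤ A := by
    have h1 := (h0 _ hpos).trans (hA _ hpos)
    rw [le_div_iff₀ (by positivity), zero_mul] at h1
    exact h1
  calc h ^ 3 * G ‖latticeVec h n‖ ≤ h ^ 3 * (A / ‖latticeVec h n‖ ^ 2) :=
        mul_le_mul_of_nonneg_left (hA _ hpos) (by positivity)
    _ ≤ h ^ 3 * (A / h ^ 2) := by
        gcongr
    _ = A * h := by field_simp

/-- There are at most `27` lattice points with `|n|∞ ≤ 1` (in any finite `U`). [folklore] -/
theorem card_filter_supNorm_le_one (U : Finset (Fin 3 → ℤ)) :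
    (U.filter fun n => (univ.sup fun j => (n j).natAbs) ≤ 1).card ≤ 27 := by
  have hsub : (U.filter fun n => (univ.sup fun j => (n j).natAbs) ≤ 1) ⊆
      Fintype.piFinset fun _ : Fin 3 => ({-1, 0, 1} : Finset ℤ) := by
    intro n hn
    rw [mem_filter] at hn
    rw [Fintype.mem_piFinset]
    intro i
    have hi : (n i).natAbs ≤ 1 := (natAbs_le_supNorm n i).trans hn.2
    have : n i = -1 ∨ n i = 0 ∨ n i = 1 := by omega
    rcases this with h | h | h <;> simp [h]
  exact (Finset.card_le_card hsub).trans (by rw [Fintype.card_piFinset]; decide)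


/-! ### Shell sums on `ℤ³` (from the `ℕ₀³` bounds of `LHYLatticeSums.lean` via `n ↦ (|nᵢ|)ᵢ`) -/

/-- Componentwise absolute value `ℤ³ → ℕ₀³` has fibres of size at most `8`. [folklore] -/
theorem card_filter_natAbs_eq_le (U : Finset (Fin 3 → ℤ)) (k : Fin 3 → ℕ) :
    (U.filter fun n => (fun j => (n j).natAbs) = k).card ≤ 8 := by
  have hsub : (U.filter fun n => (fun j => (n j).natAbs) = k) ⊆
      Fintype.piFinset fun j => ({(k j : ℤ), -(k j : ℤ)} : Finset ℤ) := by
    intro n hn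
    rw [mem_filter] at hn
    rw [Fintype.mem_piFinset]
    intro j
    have hj : (n j).natAbs = k j := congr_fun hn.2 j
    have : n j = (k j : ℤ) ∨ n j = -(k j : ℤ) := by omega
    rcases this with h | h
    · rw [h]; simp
    · rw [h]; simp
  refine (Finset.card_le_card hsub).trans ?_
  rw [Fintype.card_piFinset]
  calc ∏ j, ({(k j : ℤ), -(k j : ℤ)} : Finset ℤ).card ≤ ∏ _j : Fin 3, 2 :=
        Finset.prod_le_prod (fun j _ => Nat.zero_le _) (fun j _ => Finset.card_le_two)
    _ = 8 := by simp

/-- **Transport `ℤ³ → ℕ₀³`**: `∑_{n ∈ U} g(|n₁|,|n₂|,|n₃|) ≤ 8 ∑_{k ∈ |U|} g(k)` for `g ≥ 0`.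
[folklore] -/
theorem sum_le_eight_mul_sum_image {U : Finset (Fin 3 → ℤ)} {g : (Fin 3 → ℕ) → ℝ}
    (hg : ∀ k, 0 ≤ g k) :
    ∑ n ∈ U, g (fun j => (n j).natAbs) ≤ 8 * ∑ k ∈ U.image (fun n j => (n j).natAbs), g k := by
  rw [Finset.sum_comp, Finset.mul_sum]
  refine Finset.sum_le_sum fun k _ => ?_
  rw [nsmul_eq_mul]
  have h8 : ((U.filter fun n => (fun j => (n j).natAbs) = k).card : ℝ) ≤ 8 := by
    exact_mod_cast card_filter_natAbs_eq_le U k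
  exact mul_le_mul_of_nonneg_right h8 (hg k)

/-- **`∑_{n ∈ U, 1 ≤ |n|∞ ≤ N} |n|∞⁻³ ≤ 96(1 + log N)`** on `ℤ³`. [folklore] -/
theorem sum_inv_supNorm_pow_three_le (N : ℕ) (U : Finset (Fin 3 → ℤ)) :
    ∑ n ∈ U.filter (fun n => 0 < (univ.sup fun j => (n j).natAbs) ∧
        (univ.sup fun j => (n j).natAbs) ≤ N),
      ((((univ.sup fun j => (n j).natAbs) : ℕ) : ℝ) ^ 3)⁻¹ ≤ 96 * (1 + Real.log N) := by
  set U' := U.filter (fun n => 0 < (univ.sup fun j => (n j).natAbs) ∧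
    (univ.sup fun j => (n j).natAbs) ≤ N) with hU'
  set φ : (Fin 3 → ℤ) → (Fin 3 → ℕ) := fun n j => (n j).natAbs with hφ
  set g : (Fin 3 → ℕ) → ℝ := fun k => (((univ.sup k : ℕ) : ℝ) ^ 3)⁻¹ with hg
  have h2 := sum_le_eight_mul_sum_image (U := U') (g := g) (fun k => by positivity)
  have h3 : ∑ k ∈ U'.image φ, g k ≤ 12 * (1 + Real.log N) := by
    have hfilt : (U'.image φ).filter (fun k => 0 < univ.sup k ∧ univ.sup k ≤ N) = U'.image φ := by
      apply Finset.filter_true_of_mem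
      intro k hk
      rw [Finset.mem_image] at hk
      obtain ⟨n, hn, rfl⟩ := hk
      exact (Finset.mem_filter.1 hn).2
    have := sum_inv_sup_pow_three_le N (U'.image φ)
    rwa [hfilt] at this
  calc ∑ n ∈ U', ((((univ.sup fun j => (n j).natAbs) : ℕ) : ℝ) ^ 3)⁻¹ = ∑ n ∈ U', g (φ n) := rfl
    _ ≤ 8 * ∑ k ∈ U'.image φ, g k := h2
    _ ≤ 8 * (12 * (1 + Real.log N)) := by gcongr
    _ = 96 * (1 + Real.log N) := by ring

/-- **`∑_{n ∈ U, |n|∞ ≥ N} |n|∞⁻⁵ ≤ 192/N²`** on `ℤ³` (`N ≥ 1`). [folklore] -/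
theorem sum_inv_supNorm_pow_five_le {N : ℕ} (hN : 1 ≤ N) (U : Finset (Fin 3 → ℤ)) :
    ∑ n ∈ U.filter (fun n => N ≤ (univ.sup fun j => (n j).natAbs)),
      ((((univ.sup fun j => (n j).natAbs) : ℕ) : ℝ) ^ 5)⁻¹ ≤ 192 / (N : ℝ) ^ 2 := by
  set U' := U.filter (fun n => N ≤ (univ.sup fun j => (n j).natAbs)) with hU'
  set φ : (Fin 3 → ℤ) → (Fin 3 → ℕ) := fun n j => (n j).natAbs with hφ
  set g : (Fin 3 → ℕ) → ℝ := fun k => (((univ.sup k : ℕ) : ℝ) ^ 5)⁻¹ with hg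
  have h2 := sum_le_eight_mul_sum_image (U := U') (g := g) (fun k => by positivity)
  have h3 : ∑ k ∈ U'.image φ, g k ≤ 24 / (N : ℝ) ^ 2 := by
    have hfilt : (U'.image φ).filter (fun k => N ≤ univ.sup k) = U'.image φ := by
      apply Finset.filter_true_of_mem
      intro k hk
      rw [Finset.mem_image] at hk
      obtain ⟨n, hn, rfl⟩ := hk
      exact (Finset.mem_filter.1 hn).2
    have := sum_inv_sup_pow_five_le hN (U'.image φ)
    rwa [hfilt] at this
  calc ∑ n ∈ U', ((((univ.sup fun j => (n j).natAbs) : ℕ) : ℝ) ^ 5)⁻¹ = ∑ n ∈ U', g (φ n) := rfl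
    _ ≤ 8 * ∑ k ∈ U'.image φ, g k := h2
    _ ≤ 8 * (24 / (N : ℝ) ^ 2) := by gcongr
    _ = 192 / (N : ℝ) ^ 2 := by ring

/-! ### Tiling: `∑_n ∫_{[0,h)³} G(‖u - hn‖) du = ∫_{ℝ³} G(‖p‖) dp` -/

/-- **The cell integrals sum to the integral** (`[0,h)³` is a fundamental domain of `hℤ³`;
`tsum_lintegral_cell_sub_latticeVec` of `PeriodicBoseGasLemma32.lean` made real-valued for a
radial integrable `G ≥ 0`). [folklore] -/
theorem hasSum_cellIntegral {G : ℝ → ℝ} (hG : Integrable fun p : Space => G ‖p‖)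
    (h0 : ∀ r, 0 < r → 0 ≤ G r) {h : ℝ} (hh : 0 < h) :
    HasSum (fun n : Fin 3 → ℤ => ∫ u in cell h, G ‖u - latticeVec h n‖) (∫ p : Space, G ‖p‖) := by
  have hae : 0 ≤ᵐ[volume] fun p : Space => G ‖p‖ := by
    filter_upwards [ae_ne_point (0 : Space)] with p hp
    exact h0 _ (norm_pos_iff.2 hp)
  have htile := tsum_lintegral_cell_sub_latticeVec hh (fun p => ENNReal.ofReal (G ‖p‖))
  have hterm : ∀ n : Fin 3 → ℤ, ∫⁻ u in cell h, ENNReal.ofReal (G ‖u - latticeVec h n‖) =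
      ENNReal.ofReal (∫ u in cell h, G ‖u - latticeVec h n‖) := by
    intro n
    rw [ofReal_integral_eq_lintegral_ofReal]
    · exact integrableOn_radial_translate hG _ _
    · apply ae_restrict_of_ae
      filter_upwards [ae_ne_point (latticeVec h n)] with u hu
      exact h0 _ (norm_pos_iff.2 (sub_ne_zero.2 hu))
  have htot : ∫⁻ p, ENNReal.ofReal (G ‖p‖) = ENNReal.ofReal (∫ p : Space, G ‖p‖) :=
    (ofReal_integral_eq_lintegral_ofReal hG hae).symm
  simp_rw [hterm] at htile
  rw [htot] at htile
  have hI0 : ∀ n : Fin 3 → ℤ, 0 ≤ ∫ u in cell h, G ‖u - latticeVec h n‖ := fun n =>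
    cellIntegral_nonneg h0 h _
  have hne : ∑' n : Fin 3 → ℤ, ENNReal.ofReal (∫ u in cell h, G ‖u - latticeVec h n‖) ≠ ⊤ := by
    rw [htile]; exact ENNReal.ofReal_ne_top
  have hsum : Summable fun n : Fin 3 → ℤ => ∫ u in cell h, G ‖u - latticeVec h n‖ := by
    have := ENNReal.summable_toReal hne
    simpa [ENNReal.toReal_ofReal (hI0 _)] using this
  have htsum : ∑' n : Fin 3 → ℤ, ∫ u in cell h, G ‖u - latticeVec h n‖ = ∫ p : Space, G ‖p‖ := by
    have := congrArg ENNReal.toReal htile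
    rw [ENNReal.tsum_toReal_eq (fun n => ENNReal.ofReal_ne_top),
      ENNReal.toReal_ofReal (integral_nonneg_of_ae hae)] at this
    simpa [ENNReal.toReal_ofReal (hI0 _)] using this
  rw [← htsum]
  exact hsum.hasSum

/-! ### The Riemann-sum estimate for a radial profile -/

/-- **Cell-by-cell bound, uniformly over finite sets of cells.** Let `G ≥ 0` be a radial profile
with `G(r) ≤ A/r²`, `M`-Lipschitz on `[r₀,∞)` with `M = B₃/r₀³` (`r₀ > 0`) and with `M = B₅/r₀⁵`
(`r₀ ≥ s`), and `p ↦ G(‖p‖)` integrable on `ℝ³`. Then for `0 < h ≤ 1` and every finite `U ⊂ ℤ³`,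
`∑_{n ∈ U} |∫_{[0,h)³} G(‖u-hn‖)du - [n ≠ 0] h³G(‖hn‖)| ≤ C₁ h + C₂ h|log h|` with the explicit
constants below (near cells `|n|∞ ≤ 1`: both terms are `O(Ah)`; middle cells
`2 ≤ |n|∞ ≤ K₁ = ⌈max(s,1)/h⌉+1`: `8√3B₃h|n|∞⁻³`, summed by `∑|n|∞⁻³ ≤ 96(1+log K₁)`; far cells:
`32√3B₅h⁻¹|n|∞⁻⁵`, summed by `∑_{|n|∞>K₁}|n|∞⁻⁵ ≤ 192/(K₁+1)² ≤ 192h²`).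
[cite: BastiCenatiempoSchlein2021, §3, the paragraph after (3.22)] -/
theorem sum_abs_cellIntegral_sub_pointTerm_le {G : ℝ → ℝ} {A B₃ B₅ s h : ℝ}
    (hG : Integrable fun p : Space => G ‖p‖) (h0 : ∀ r, 0 < r → 0 ≤ G r)
    (hA : ∀ r, 0 < r → G r ≤ A / r ^ 2)
    (hB₃ : ∀ r₀ r r' : ℝ, 0 < r₀ → r₀ ≤ r → r₀ ≤ r' → |G r - G r'| ≤ B₃ / r₀ ^ 3 * |r - r'|)
    (hB₅ : ∀ r₀ r r' : ℝ, s ≤ r₀ → r₀ ≤ r → r₀ ≤ r' → |G r - G r'| ≤ B₅ / r₀ ^ 5 * |r - r'|)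
    (hh : 0 < h) (hh1 : h ≤ 1) (U : Finset (Fin 3 → ℤ)) :
    ∑ n ∈ U, |(∫ u in cell h, G ‖u - latticeVec h n‖) -
        (if n = 0 then 0 else h ^ 3 * G ‖latticeVec h n‖)| ≤
      (27 * (16 * Real.pi + 1) * A + 768 * Real.sqrt 3 * B₃ * (1 + Real.log (max s 1 + 2)) +
          6144 * Real.sqrt 3 * B₅) * h + 768 * Real.sqrt 3 * B₃ * h * |Real.log h| := by
  -- notation
  set K : (Fin 3 → ℤ) → ℕ := fun n => univ.sup fun j => (n j).natAbs with hKdef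
  set I : (Fin 3 → ℤ) → ℝ := fun n => ∫ u in cell h, G ‖u - latticeVec h n‖ with hIdef
  set a : (Fin 3 → ℤ) → ℝ := fun n => if n = 0 then 0 else h ^ 3 * G ‖latticeVec h n‖ with hadef
  set m : ℝ := max s 1 with hm
  have hm1 : 1 ≤ m := le_max_right _ _
  have hms : s ≤ m := le_max_left _ _
  set K₁ : ℕ := ⌈m / h⌉₊ + 1 with hK₁
  have hK₁m : m / h ≤ (K₁ : ℝ) := by
    rw [hK₁]; push_cast; exact (Nat.le_ceil _).trans (by linarith)
  have hK₁1 : (1 : ℝ) ≤ K₁ := by rw [hK₁]; push_cast; linarith [Nat.cast_nonneg (α := ℝ) ⌈m / h⌉₊]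
  have hmh : 1 ≤ m / h := by rw [le_div_iff₀ hh]; linarith
  -- non-negativity of the constants
  have hA0 : 0 ≤ A := by
    have h1 := (h0 1 one_pos).trans (hA 1 one_pos)
    simpa using h1
  have hB₃0 : 0 ≤ B₃ := by
    have h1 := hB₃ 1 2 1 one_pos (by norm_num) le_rfl
    rw [show (2 : ℝ) - 1 = 1 by norm_num, abs_one, mul_one, one_pow, div_one] at h1
    exact (abs_nonneg _).trans h1
  have hB₅0 : 0 ≤ B₅ := by
    have h1 := hB₅ m (m + 1) m hms (by linarith) le_rfl
    rw [show m + 1 - m = 1 by ring, abs_one, mul_one] at h1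
    have h2 : 0 ≤ B₅ / m ^ 5 := (abs_nonneg _).trans h1
    rw [le_div_iff₀ (by positivity), zero_mul] at h2
    exact h2
  have h3 : (0 : ℝ) < Real.sqrt 3 := Real.sqrt_pos.2 (by norm_num)
  -- (1) near cells
  have hnear : ∀ n ∈ U.filter (fun n => K n ≤ 1), |I n - a n| ≤ (16 * Real.pi + 1) * A * h := by
    intro n hn
    have hKn : K n ≤ 1 := (mem_filter.1 hn).2
    have hI : 0 ≤ I n ∧ I n ≤ 16 * Real.pi * A * h :=
      ⟨cellIntegral_nonneg h0 h _, cellIntegral_le_near hG hA hA0 hh hKn⟩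
    have ha : 0 ≤ a n ∧ a n ≤ A * h := by
      by_cases hn0 : n = 0
      · simp only [hadef, if_pos hn0]
        exact ⟨le_rfl, by positivity⟩
      · simp only [hadef, if_neg hn0]
        exact pointTerm_near h0 hA hh hn0 hKn
    rw [abs_le]
    constructor <;> nlinarith [hI.1, hI.2, ha.1, ha.2, Real.pi_pos]
  have hsum1 : ∑ n ∈ U.filter (fun n => K n ≤ 1), |I n - a n| ≤ 27 * ((16 * Real.pi + 1) * A * h) := by
    calc ∑ n ∈ U.filter (fun n => K n ≤ 1), |I n - a n|
        ≤ ∑ _n ∈ U.filter (fun n => K n ≤ 1), (16 * Real.pi + 1) * A * h := Finset.sum_le_sum hnear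
      _ = ((U.filter (fun n => K n ≤ 1)).card : ℝ) * ((16 * Real.pi + 1) * A * h) := by
          rw [Finset.sum_const, nsmul_eq_mul]
      _ ≤ 27 * ((16 * Real.pi + 1) * A * h) := by
          gcongr
          exact_mod_cast card_filter_supNorm_le_one U
  -- (2) middle cells `2 ≤ K ≤ K₁`
  have hmid : ∀ n ∈ (U.filter (fun n => ¬ K n ≤ 1)).filter (fun n => K n ≤ K₁),
      |I n - a n| ≤ 8 * Real.sqrt 3 * B₃ * h * (((K n : ℕ) : ℝ) ^ 3)⁻¹ := by
    intro n hn
    rw [mem_filter, mem_filter] at hn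
    have hK2 : 2 ≤ K n := by have := hn.1.2; omega
    have hK2r : (2 : ℝ) ≤ K n := by exact_mod_cast hK2
    have hn0 : n ≠ 0 := by rintro rfl; simp [hKdef] at hK2
    simp only [hadef, if_neg hn0]
    have hr₀ : 0 < h * (((K n : ℕ) : ℝ) - 1) := mul_pos hh (by linarith)
    have hcell := abs_cellIntegral_sub_le (M := B₃ / (h * (((K n : ℕ) : ℝ) - 1)) ^ 3) hG hh n hK2
      (fun r r' hr hr' => hB₃ _ r r' hr₀ hr hr')
    refine hcell.trans ?_
    -- `B₃/(h(K-1))³ · √3h · h³ = √3B₃h/(K-1)³ ≤ 8√3B₃h/K³`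
    have hK1 : ((K n : ℕ) : ℝ) / 2 ≤ ((K n : ℕ) : ℝ) - 1 := by linarith
    have hpow : (((K n : ℕ) : ℝ) / 2) ^ 3 ≤ (((K n : ℕ) : ℝ) - 1) ^ 3 :=
      pow_le_pow_left₀ (by positivity) hK1 3
    rw [mul_pow, show B₃ / (h ^ 3 * (((K n : ℕ) : ℝ) - 1) ^ 3) * (Real.sqrt 3 * h) * h ^ 3 =
      Real.sqrt 3 * B₃ * h / (((K n : ℕ) : ℝ) - 1) ^ 3 by field_simp]
    rw [div_le_iff₀ (pow_pos (by linarith) 3)]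
    calc Real.sqrt 3 * B₃ * h = 8 * Real.sqrt 3 * B₃ * h * (((K n : ℕ) : ℝ) ^ 3)⁻¹ * (((K n : ℕ) : ℝ) / 2) ^ 3 := by
          field_simp
          ring
      _ ≤ 8 * Real.sqrt 3 * B₃ * h * (((K n : ℕ) : ℝ) ^ 3)⁻¹ * (((K n : ℕ) : ℝ) - 1) ^ 3 := by
          gcongr
  have hlogK₁ : Real.log K₁ ≤ Real.log (m + 2) + |Real.log h| := by
    have hK₁le : (K₁ : ℝ) ≤ (m + 2) / h := by
      rw [hK₁]; push_cast
      have := Nat.ceil_lt_add_one (show 0 ≤ m / h by positivity)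
      rw [le_div_iff₀ hh]
      have hmh' : (⌈m / h⌉₊ : ℝ) * h ≤ (m / h + 1) * h := by
        exact mul_le_mul_of_nonneg_right this.le hh.le
      rw [add_mul, div_mul_cancel₀ _ hh.ne'] at hmh'
      nlinarith
    have hlogh : |Real.log h| = -Real.log h := abs_of_nonpos (Real.log_nonpos hh.le hh1)
    calc Real.log K₁ ≤ Real.log ((m + 2) / h) := Real.log_le_log (by positivity) hK₁le
      _ = Real.log (m + 2) - Real.log h := Real.log_div (by positivity) hh.ne'
      _ = Real.log (m + 2) + |Real.log h| := by rw [hlogh]; ring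
  have hsum2 : ∑ n ∈ (U.filter (fun n => ¬ K n ≤ 1)).filter (fun n => K n ≤ K₁), |I n - a n| ≤
      8 * Real.sqrt 3 * B₃ * h * (96 * (1 + Real.log (m + 2) + |Real.log h|)) := by
    calc ∑ n ∈ (U.filter (fun n => ¬ K n ≤ 1)).filter (fun n => K n ≤ K₁), |I n - a n|
        ≤ ∑ n ∈ (U.filter (fun n => ¬ K n ≤ 1)).filter (fun n => K n ≤ K₁),
            8 * Real.sqrt 3 * B₃ * h * (((K n : ℕ) : ℝ) ^ 3)⁻¹ := Finset.sum_le_sum hmid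
      _ = 8 * Real.sqrt 3 * B₃ * h * ∑ n ∈ (U.filter (fun n => ¬ K n ≤ 1)).filter (fun n => K n ≤ K₁),
            (((K n : ℕ) : ℝ) ^ 3)⁻¹ := by rw [Finset.mul_sum]
      _ ≤ 8 * Real.sqrt 3 * B₃ * h * ∑ n ∈ U.filter (fun n => 0 < K n ∧ K n ≤ K₁),
            (((K n : ℕ) : ℝ) ^ 3)⁻¹ := by
          refine mul_le_mul_of_nonneg_left
            (Finset.sum_le_sum_of_subset_of_nonneg ?_ (fun _ _ _ => by positivity)) (by positivity)
          intro n hn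
          rw [mem_filter, mem_filter] at hn
          rw [mem_filter]
          exact ⟨hn.1.1, by omega, hn.2⟩
      _ ≤ 8 * Real.sqrt 3 * B₃ * h * (96 * (1 + Real.log K₁)) := by
          gcongr
          exact sum_inv_supNorm_pow_three_le K₁ U
      _ ≤ 8 * Real.sqrt 3 * B₃ * h * (96 * (1 + Real.log (m + 2) + |Real.log h|)) := by
          gcongr 8 * Real.sqrt 3 * B₃ * h * (96 * ?_)
          linarith
  -- (3) far cells `K > K₁`
  have hfar : ∀ n ∈ (U.filter (fun n => ¬ K n ≤ 1)).filter (fun n => ¬ K n ≤ K₁),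
      |I n - a n| ≤ 32 * Real.sqrt 3 * B₅ * h⁻¹ * (((K n : ℕ) : ℝ) ^ 5)⁻¹ := by
    intro n hn
    rw [mem_filter, mem_filter] at hn
    have hKK : K₁ + 1 ≤ K n := by have := hn.2; omega
    have hK2 : 2 ≤ K n := by have := hn.1.2; omega
    have hK2r : (2 : ℝ) ≤ K n := by exact_mod_cast hK2
    have hKKr : (K₁ : ℝ) + 1 ≤ K n := by exact_mod_cast hKK
    have hn0 : n ≠ 0 := by rintro rfl; simp [hKdef] at hK2
    simp only [hadef, if_neg hn0]
    have hr₀s : s ≤ h * (((K n : ℕ) : ℝ) - 1) := by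
      calc s ≤ m := hms
        _ = h * (m / h) := by field_simp
        _ ≤ h * (K₁ : ℝ) := by gcongr
        _ ≤ h * (((K n : ℕ) : ℝ) - 1) := by gcongr; linarith
    have hr₀ : 0 < h * (((K n : ℕ) : ℝ) - 1) := mul_pos hh (by linarith)
    have hcell := abs_cellIntegral_sub_le (M := B₅ / (h * (((K n : ℕ) : ℝ) - 1)) ^ 5) hG hh n hK2
      (fun r r' hr hr' => hB₅ _ r r' hr₀s hr hr')
    refine hcell.trans ?_
    have hK1 : ((K n : ℕ) : ℝ) / 2 ≤ ((K n : ℕ) : ℝ) - 1 := by linarith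
    have hpow : (((K n : ℕ) : ℝ) / 2) ^ 5 ≤ (((K n : ℕ) : ℝ) - 1) ^ 5 :=
      pow_le_pow_left₀ (by positivity) hK1 5
    rw [mul_pow, show B₅ / (h ^ 5 * (((K n : ℕ) : ℝ) - 1) ^ 5) * (Real.sqrt 3 * h) * h ^ 3 =
      Real.sqrt 3 * B₅ * h⁻¹ / (((K n : ℕ) : ℝ) - 1) ^ 5 by field_simp]
    rw [div_le_iff₀ (pow_pos (by linarith) 5)]
    calc Real.sqrt 3 * B₅ * h⁻¹
        = 32 * Real.sqrt 3 * B₅ * h⁻¹ * (((K n : ℕ) : ℝ) ^ 5)⁻¹ * (((K n : ℕ) : ℝ) / 2) ^ 5 := by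
          field_simp
          ring
      _ ≤ 32 * Real.sqrt 3 * B₅ * h⁻¹ * (((K n : ℕ) : ℝ) ^ 5)⁻¹ * (((K n : ℕ) : ℝ) - 1) ^ 5 := by
          gcongr
  have hsum3 : ∑ n ∈ (U.filter (fun n => ¬ K n ≤ 1)).filter (fun n => ¬ K n ≤ K₁), |I n - a n| ≤
      32 * Real.sqrt 3 * B₅ * h⁻¹ * (192 * h ^ 2) := by
    have hK₁h : 192 / ((K₁ + 1 : ℕ) : ℝ) ^ 2 ≤ 192 * h ^ 2 := by
      have h1h : h⁻¹ ≤ ((K₁ + 1 : ℕ) : ℝ) := by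
        push_cast
        calc h⁻¹ = 1 / h := (one_div h).symm
          _ ≤ m / h := by gcongr
          _ ≤ K₁ := hK₁m
          _ ≤ (K₁ : ℝ) + 1 := by linarith
      rw [div_le_iff₀ (by positivity)]
      calc (192 : ℝ) = 192 * h ^ 2 * (h⁻¹) ^ 2 := by field_simp
        _ ≤ 192 * h ^ 2 * ((K₁ + 1 : ℕ) : ℝ) ^ 2 := by gcongr
    calc ∑ n ∈ (U.filter (fun n => ¬ K n ≤ 1)).filter (fun n => ¬ K n ≤ K₁), |I n - a n|
        ≤ ∑ n ∈ (U.filter (fun n => ¬ K n ≤ 1)).filter (fun n => ¬ K n ≤ K₁),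
            32 * Real.sqrt 3 * B₅ * h⁻¹ * (((K n : ℕ) : ℝ) ^ 5)⁻¹ := Finset.sum_le_sum hfar
      _ = 32 * Real.sqrt 3 * B₅ * h⁻¹ * ∑ n ∈ (U.filter (fun n => ¬ K n ≤ 1)).filter (fun n => ¬ K n ≤ K₁),
            (((K n : ℕ) : ℝ) ^ 5)⁻¹ := by rw [Finset.mul_sum]
      _ ≤ 32 * Real.sqrt 3 * B₅ * h⁻¹ * ∑ n ∈ U.filter (fun n => K₁ + 1 ≤ K n),
            (((K n : ℕ) : ℝ) ^ 5)⁻¹ := by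
          refine mul_le_mul_of_nonneg_left
            (Finset.sum_le_sum_of_subset_of_nonneg ?_ (fun _ _ _ => by positivity)) (by positivity)
          intro n hn
          rw [mem_filter, mem_filter] at hn
          rw [mem_filter]
          exact ⟨hn.1.1, by omega⟩
      _ ≤ 32 * Real.sqrt 3 * B₅ * h⁻¹ * (192 / ((K₁ + 1 : ℕ) : ℝ) ^ 2) := by
          gcongr
          exact sum_inv_supNorm_pow_five_le (by omega) U
      _ ≤ 32 * Real.sqrt 3 * B₅ * h⁻¹ * (192 * h ^ 2) := by gcongr
  -- assemble
  rw [← Finset.sum_filter_add_sum_filter_not U (fun n => K n ≤ 1),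
    ← Finset.sum_filter_add_sum_filter_not (U.filter fun n => ¬ K n ≤ 1) (fun n => K n ≤ K₁)]
  have hlog0 : 0 ≤ |Real.log h| := abs_nonneg _
  have hlogm : 0 ≤ Real.log (m + 2) := Real.log_nonneg (by linarith)
  have htot := add_le_add hsum1 (add_le_add hsum2 hsum3)
  refine htot.trans (le_of_eq ?_)
  field_simp
  ring

/-- **The Riemann-sum theorem for a radial profile on the punctured lattice `hℤ³ ∖ 0`.** Under the
hypotheses of `sum_abs_cellIntegral_sub_pointTerm_le`, for `0 < h ≤ 1` the lattice sum
`∑_{n ∈ ℤ³∖0} G(‖hn‖)` converges and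
`|h³ ∑_{n ≠ 0} G(‖hn‖) - ∫_{ℝ³} G(‖p‖) dp| ≤ C₁h + C₂h|log h|`. [cite: BastiCenatiempoSchlein2021, §3, (3.21)–(3.22) and the paragraph after (3.22)] -/
theorem abs_latticeSum_sub_integral_le {G : ℝ → ℝ} {A B₃ B₅ s h : ℝ}
    (hG : Integrable fun p : Space => G ‖p‖) (h0 : ∀ r, 0 < r → 0 ≤ G r)
    (hA : ∀ r, 0 < r → G r ≤ A / r ^ 2)
    (hB₃ : ∀ r₀ r r' : ℝ, 0 < r₀ → r₀ ≤ r → r₀ ≤ r' → |G r - G r'| ≤ B₃ / r₀ ^ 3 * |r - r'|)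
    (hB₅ : ∀ r₀ r r' : ℝ, s ≤ r₀ → r₀ ≤ r → r₀ ≤ r' → |G r - G r'| ≤ B₅ / r₀ ^ 5 * |r - r'|)
    (hh : 0 < h) (hh1 : h ≤ 1) :
    Summable (fun n : Fin 3 → ℤ => if n = 0 then (0 : ℝ) else G ‖latticeVec h n‖) ∧
      |h ^ 3 * (∑' n : Fin 3 → ℤ, if n = 0 then (0 : ℝ) else G ‖latticeVec h n‖) -
          ∫ p : Space, G ‖p‖| ≤
        (27 * (16 * Real.pi + 1) * A + 768 * Real.sqrt 3 * B₃ * (1 + Real.log (max s 1 + 2)) +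
          6144 * Real.sqrt 3 * B₅) * h + 768 * Real.sqrt 3 * B₃ * h * |Real.log h| := by
  set E : ℝ := (27 * (16 * Real.pi + 1) * A + 768 * Real.sqrt 3 * B₃ * (1 + Real.log (max s 1 + 2)) +
    6144 * Real.sqrt 3 * B₅) * h + 768 * Real.sqrt 3 * B₃ * h * |Real.log h| with hE
  set I : (Fin 3 → ℤ) → ℝ := fun n => ∫ u in cell h, G ‖u - latticeVec h n‖ with hIdef
  set a : (Fin 3 → ℤ) → ℝ := fun n => if n = 0 then 0 else h ^ 3 * G ‖latticeVec h n‖ with hadef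
  have hfin : ∀ U : Finset (Fin 3 → ℤ), ∑ n ∈ U, |I n - a n| ≤ E := fun U =>
    sum_abs_cellIntegral_sub_pointTerm_le hG h0 hA hB₃ hB₅ hh hh1 U
  have hDabs : Summable fun n => |I n - a n| :=
    summable_of_sum_le (fun n => abs_nonneg _) hfin
  have hD : Summable fun n => I n - a n := summable_abs_iff.1 hDabs
  have hI : HasSum I (∫ p : Space, G ‖p‖) := hasSum_cellIntegral hG h0 hh
  have ha : Summable a := by
    have := hI.summable.sub hD
    simpa using this
  have hite : (fun n : Fin 3 → ℤ => if n = 0 then (0 : ℝ) else G ‖latticeVec h n‖) =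
      fun n => (h ^ 3)⁻¹ * a n := by
    funext n
    by_cases hn : n = 0
    · simp [hadef, hn]
    · simp only [hadef, if_neg hn]
      field_simp
  refine ⟨by rw [hite]; exact ha.mul_left _, ?_⟩
  rw [hite, tsum_mul_left, ← mul_assoc, mul_inv_cancel₀ (by positivity), one_mul]
  have hIa : ∑' n, (I n - a n) = (∫ p : Space, G ‖p‖) - ∑' n, a n := by
    rw [hI.summable.tsum_sub ha, hI.tsum_eq]
  have haD : ∑' n, a n - (∫ p : Space, G ‖p‖) = -∑' n, (I n - a n) := by rw [hIa]; ring
  rw [haD, abs_neg]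
  have hnorm : Summable fun n => ‖I n - a n‖ := hDabs
  have h1 : ‖∑' n, (I n - a n)‖ ≤ ∑' n, ‖I n - a n‖ := norm_tsum_le_tsum_norm hnorm
  have h2 : ∑' n, ‖I n - a n‖ ≤ E := hnorm.tsum_le_of_sum_le hfin
  exact h1.trans h2


/-! ### The LHY integrand: `∑_{v ∈ hℤ³∖0} F_b(v) h³ → ∫ F_b = (32√2π/15) b^{5/2}` with rate `h log(1/h)` -/

/-- **The Lee–Huang–Yang Riemann sum.** For `b > 0` and `0 < h ≤ 1` the Bogoliubov integrand
`F_b(v) = √(|v|⁴+2b|v|²) - |v|² - b + b²/(2|v|²)` summed over the punctured lattice `hℤ³ ∖ 0`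
converges, and `|h³ ∑_{n ∈ ℤ³∖0} F_b(hn) - (32√2π/15) b²√b| ≤ C_b h (1 + |log h|)` with the explicit
`C_b` below (`∫_{ℝ³} F_b = (32√2π/15) b^{5/2}` is `integral_bogoliubov`).
[cite: BastiCenatiempoSchlein2021, §3, (3.21)–(3.22): "Recognizing that (3.21) defines a Riemann sum …"] -/
theorem lhy_latticeSum {b h : ℝ} (hb : 0 < b) (hh : 0 < h) (hh1 : h ≤ 1) :
    Summable (fun n : Fin 3 → ℤ => if n = 0 then (0 : ℝ) else
      (Real.sqrt (‖latticeVec h n‖ ^ 4 + 2 * b * ‖latticeVec h n‖ ^ 2) - ‖latticeVec h n‖ ^ 2 - b +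
        b ^ 2 / (2 * ‖latticeVec h n‖ ^ 2))) ∧
    |h ^ 3 * (∑' n : Fin 3 → ℤ, if n = 0 then (0 : ℝ) else
      (Real.sqrt (‖latticeVec h n‖ ^ 4 + 2 * b * ‖latticeVec h n‖ ^ 2) - ‖latticeVec h n‖ ^ 2 - b +
        b ^ 2 / (2 * ‖latticeVec h n‖ ^ 2))) - 32 * Real.sqrt 2 * Real.pi / 15 * b ^ 2 * Real.sqrt b| ≤
      (27 * (16 * Real.pi + 1) * (b ^ 2 / 2) +
          768 * Real.sqrt 3 * (6 * b ^ 2) * (1 + Real.log (max (Real.sqrt b) 1 + 2)) +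
          6144 * Real.sqrt 3 * (3 * b ^ 3) + 768 * Real.sqrt 3 * (6 * b ^ 2)) * h * (1 + |Real.log h|) := by
  have hmain := abs_latticeSum_sub_integral_le
    (G := fun r : ℝ => Real.sqrt (r ^ 4 + 2 * b * r ^ 2) - r ^ 2 - b + b ^ 2 / (2 * r ^ 2))
    (A := b ^ 2 / 2) (B₃ := 6 * b ^ 2) (B₅ := 3 * b ^ 3) (s := Real.sqrt b) (h := h)
    (integrable_bogoliubov hb) (fun r hr => lhyF_nonneg hb hr)
    (fun r hr => by rw [div_div]; exact lhyF_le_sq_div hb hr)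
    (fun r₀ r r' hr₀ hr hr' => abs_lhyF_sub_le_three hb hr₀ hr hr')
    (fun r₀ r r' hr₀ hr hr' => abs_lhyF_sub_le_five hb hr₀ hr hr') hh hh1
  rw [integral_bogoliubov hb] at hmain
  refine ⟨hmain.1, hmain.2.trans ?_⟩
  have hlog : 0 ≤ |Real.log h| := abs_nonneg _
  have h3 : 0 ≤ Real.sqrt 3 := Real.sqrt_nonneg _
  have hlm : 0 ≤ Real.log (max (Real.sqrt b) 1 + 2) :=
    Real.log_nonneg (by linarith [le_max_right (Real.sqrt b) 1])
  have hπ := Real.pi_pos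
  nlinarith [mul_nonneg (mul_nonneg (by positivity : (0 : ℝ) ≤ 27 * (16 * Real.pi + 1) * (b ^ 2 / 2) +
      768 * Real.sqrt 3 * (6 * b ^ 2) * (1 + Real.log (max (Real.sqrt b) 1 + 2)) +
      6144 * Real.sqrt 3 * (3 * b ^ 3)) hh.le) hlog,
    mul_nonneg (by positivity : (0 : ℝ) ≤ 768 * Real.sqrt 3 * (6 * b ^ 2)) hh.le]

/-- The integrand of [BastiCenatiempoSchlein2021, (3.21)] is `F_b` with `b = 8π𝔞`. [folklore] -/
theorem lhyF_bcs_eq (𝔞 r : ℝ) :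
    Real.sqrt (r ^ 4 + 16 * Real.pi * 𝔞 * r ^ 2) - r ^ 2 - 8 * Real.pi * 𝔞 +
        (8 * Real.pi * 𝔞) ^ 2 / (2 * r ^ 2) =
      Real.sqrt (r ^ 4 + 2 * (8 * Real.pi * 𝔞) * r ^ 2) - r ^ 2 - (8 * Real.pi * 𝔞) +
        (8 * Real.pi * 𝔞) ^ 2 / (2 * r ^ 2) := by
  ring_nf

/-- **[BCS2021, §3], the last step: the Riemann sum (3.21) versus the LHY integral.** For `𝔞 > 0`
there is `C > 0` such that for all `0 < h ≤ 1` (in the paper `h = 2πN^{-κ/2}`), with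
`F(v) = √(v⁴+16π𝔞v²) - v² - 8π𝔞 + (8π𝔞)²/(2v²)`: the sum `∑_{v ∈ hℤ³∖0} F(v)` converges and
`|h³ ∑_{v ∈ hℤ³∖0} F(v) - ∫_{ℝ³} F| ≤ C h (1 + |log h|)`, where
`∫_{ℝ³} F = 2(2π)³ · 4π𝔞 · (128/(15√π)) 𝔞^{3/2}` (`integral_lhyIntegrand`). This is the estimate
behind "we can replace … the sum … With the rescaling `v → N^{κ/2}v` … Recognizing that (3.21)
defines a Riemann sum … we conclude (3.22)", with the printed justification (drop `|v| ≲` a few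
cells using `|F(v)| ≤ C/v²`, compare cell values by `|∇F(v)| ≤ C|v|⁻³(1+v²)⁻¹` elsewhere).
[cite: BastiCenatiempoSchlein2021, §3, (3.21)–(3.22) and the paragraph following (3.22)] -/
theorem BastiCenatiempoSchlein2021_lhyRiemannSum {𝔞 : ℝ} (h𝔞 : 0 < 𝔞) :
    ∃ C : ℝ, 0 < C ∧ ∀ h : ℝ, 0 < h → h ≤ 1 →
      Summable (fun n : Fin 3 → ℤ => if n = 0 then (0 : ℝ) else
        (Real.sqrt (‖latticeVec h n‖ ^ 4 + 16 * Real.pi * 𝔞 * ‖latticeVec h n‖ ^ 2) -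
          ‖latticeVec h n‖ ^ 2 - 8 * Real.pi * 𝔞 + (8 * Real.pi * 𝔞) ^ 2 / (2 * ‖latticeVec h n‖ ^ 2))) ∧
      |h ^ 3 * (∑' n : Fin 3 → ℤ, if n = 0 then (0 : ℝ) else
        (Real.sqrt (‖latticeVec h n‖ ^ 4 + 16 * Real.pi * 𝔞 * ‖latticeVec h n‖ ^ 2) -
          ‖latticeVec h n‖ ^ 2 - 8 * Real.pi * 𝔞 + (8 * Real.pi * 𝔞) ^ 2 / (2 * ‖latticeVec h n‖ ^ 2))) -
        2 * (2 * Real.pi) ^ 3 * (4 * Real.pi * 𝔞 * (lhyConstant * Real.sqrt (𝔞 ^ 3)))| ≤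
        C * h * (1 + |Real.log h|) := by
  set b : ℝ := 8 * Real.pi * 𝔞 with hb
  have hb0 : 0 < b := by positivity
  set C : ℝ := 27 * (16 * Real.pi + 1) * (b ^ 2 / 2) +
    768 * Real.sqrt 3 * (6 * b ^ 2) * (1 + Real.log (max (Real.sqrt b) 1 + 2)) +
    6144 * Real.sqrt 3 * (3 * b ^ 3) + 768 * Real.sqrt 3 * (6 * b ^ 2) with hC
  have hlm : 0 ≤ Real.log (max (Real.sqrt b) 1 + 2) :=
    Real.log_nonneg (by linarith [le_max_right (Real.sqrt b) 1])
  have hC0 : 0 < C := by positivity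
  refine ⟨C, hC0, fun h hh hh1 => ?_⟩
  have hfun : (fun n : Fin 3 → ℤ => if n = 0 then (0 : ℝ) else
      (Real.sqrt (‖latticeVec h n‖ ^ 4 + 16 * Real.pi * 𝔞 * ‖latticeVec h n‖ ^ 2) -
        ‖latticeVec h n‖ ^ 2 - 8 * Real.pi * 𝔞 + (8 * Real.pi * 𝔞) ^ 2 / (2 * ‖latticeVec h n‖ ^ 2))) =
      fun n : Fin 3 → ℤ => if n = 0 then (0 : ℝ) else
      (Real.sqrt (‖latticeVec h n‖ ^ 4 + 2 * b * ‖latticeVec h n‖ ^ 2) - ‖latticeVec h n‖ ^ 2 - b +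
        b ^ 2 / (2 * ‖latticeVec h n‖ ^ 2)) := by
    funext n
    rw [lhyF_bcs_eq]
  have hval : 2 * (2 * Real.pi) ^ 3 * (4 * Real.pi * 𝔞 * (lhyConstant * Real.sqrt (𝔞 ^ 3))) =
      32 * Real.sqrt 2 * Real.pi / 15 * b ^ 2 * Real.sqrt b := by
    rw [← integral_lhyIntegrand h𝔞, ← integral_bogoliubov hb0]
    congr 1
    funext v
    exact lhyF_bcs_eq 𝔞 ‖v‖
  rw [hfun, hval]
  exact lhy_latticeSum hb0 hh hh1

end Literature.MathematicalPhysics.QuantumManyBody.BoseGas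

end
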